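import Summits.RiemannHypothesis.RiemannHypothesis.Theorems.Splittings.NbBddNaturalThreeLines
import Mathlib.NumberTheory.LSeries.Injectivity
import Mathlib.NumberTheory.LSeries.Dirichlet
import Mathlib.Algebra.Polynomial.Roots
import Mathlib.Algebra.Polynomial.BigOperators
import Mathlib.Data.Nat.PrimeFin
import Mathlib.Topology.MetricSpace.Sequences
import Mathlib.Analysis.SpecialFunctions.Sqrt
import HarnessLib

/-!
# RH-EQUIVALENT·SPLITTING CENSUS (nb, neg) · V35 «SPARSE»: no boundedly-supported Nyman–Beurling approximation — refuted unconditionally and WITHOUT any zero of `ζ`; nothing here bears on the truth of RH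

LABEL (line 1): RH-EQUIVALENT·SPLITTING (cell `rh-split`, seat (nb, neg), generation 10, census
candidate V35).  The conjunct «SPARSE(B)»: *for every `ε > 0` some Dirichlet polynomial
`A(s) = Σ_{n<N} a_n (n+1)^{-s}` (any length `N`) with AT MOST `B` NONZERO COEFFICIENTS has
`I(N,a) = ∫ |1 - ζA|²(1/2+it) dt/(1/4+t²) < ε`*.  SPARSE(B) ⟹ `NbThesis` ⟹ RH trivially, so a
would-be splitting `SPARSE(B) ∧ ⊤ ⟹ RH` is bookkeeping; here SPARSE(B) is REFUTED for every `B`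
(`not_nbSparseApprox`), i.e. the number of nonzero coefficients of near-optimal Nyman–Beurling
approximants must tend to infinity (`nbSparse_floor`).  After LENGTH (BDBLS, the tree's
`BaezDuarteU.lowerBound_real`) and MASS (V34, `Splittings.NbCoefficientMass`) this is the third
resource law of the census, and the first whose proof uses NO zero of `ζ` at all.

## The argument (shift recurrence + uniqueness of Dirichlet coefficients)

1. If `a` is supported on `S`, `|S| ≤ B`, put `p = ∏_{j∈S} (X - 1/(j+1))` (monic, `deg ≤ B`).  Then
   `Σ_i p_i A(s+i) = Σ_j a_j (j+1)^{-s} p(1/(j+1)) = 0` for EVERY `s`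
   (`sum_coeff_mul_dirichletPoly_shift_eq_zero`): a sparse Dirichlet polynomial satisfies a short
   recurrence in the unit shift.
2. The tree's point-evaluation bound `NbBddNatural.norm_nbG_le_of_re` (Cauchy formula on
   `Re s > 1/2` + the lossy-kernel estimate; no zeros involved) gives `|1 - ζ(z)A(z)| ≤ √I·|z|²|z+1|²`
   for `Re z ≥ 2` (`norm_one_sub_zeta_mul_dirichletPoly_le`), so along approximants with `I → 0`:
   `A_k(z) → 1/ζ(z)` pointwise on `Re z ≥ 2` (`tendsto_dirichletPoly_of_lintegral_le`).
3. Normalise the coefficient vectors of `p_k` in `ℂ^{B+1}` (sup norm `1`), extract a convergent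
   subsequence (Bolzano–Weierstrass), pass to the limit in the recurrence:
   `Σ_i w_i/ζ(x+i) = 0` for all real `x ≥ 2`, `‖w‖ = 1`.
4. `1/ζ(s) = Σ μ(n)n^{-s}` (Mathlib `LSeries_zeta_mul_Lseries_moebius`), so the Dirichlet series of
   `b(n) = μ(n)·P(1/n)`, `P = Σ w_i X^i`, vanishes for `x ≥ 2`; uniqueness of Dirichlet coefficients
   (Mathlib `LSeries_eventually_eq_zero_iff'`) gives `b = 0`, hence `P(1/q) = 0` for every prime `q`,
   so `P = 0` (`eq_zero_of_sum_mul_inv_zeta_shift_eq_zero`) — contradicting `‖w‖ = 1`.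

Zero definitions; the E_NB integrand is the route's, verbatim.  Standard axioms only.

HONEST LABEL: «SPLITTING SEARCH over kernel-typed RH-EQUIVALENCES; a splitting A ∧ B ⟹ RH is
CONDITIONAL bookkeeping unless A and B are both proved; nothing here bears on the truth of RH.»
-/

set_option linter.dupNamespace false

noncomputable section

open Complex MeasureTheory Filter Topology Polynomial LSeries

namespace Summit.RiemannHypothesis.RiemannHypothesis.Theorems.Splittings.NbSparsity

open Literature.NumberTheory.LFunctions
open Summit.RiemannHypothesis.RiemannHypothesis.Theorems.Splittings.NbBddNatural

/-! ## 1. The shift recurrence of a sparse Dirichlet polynomial -/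

/-- **Shift recurrence.** If `a` vanishes off `S` and `p = ∏_{j ∈ S} (X - (j+1)⁻¹)` has
`natDegree < m`, then `∑_{i<m} p_i · A_a(s+i) = 0` for every `s`. -/
theorem sum_coeff_mul_dirichletPoly_shift_eq_zero {N : ℕ} (a : Fin N → ℂ) (S : Finset (Fin N))
    (hS : ∀ n, n ∉ S → a n = 0) {p : ℂ[X]}
    (hp : p = ∏ j ∈ S, (X - C ((((j : ℕ) : ℂ) + 1)⁻¹))) {m : ℕ} (hm : p.natDegree < m) (s : ℂ) :
    ∑ i : Fin m, p.coeff i * dirichletPoly a (s + ((i : ℕ) : ℂ)) = 0 := by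
  have hroot : ∀ j ∈ S, p.eval ((((j : ℕ) : ℂ) + 1)⁻¹) = 0 := by
    intro j hj
    rw [hp, eval_prod]
    exact Finset.prod_eq_zero hj (by simp)
  have hterm : ∀ (j : Fin N) (i : ℕ), (((j : ℕ) : ℂ) + 1) ^ (-(s + (i : ℂ))) =
      (((j : ℕ) : ℂ) + 1) ^ (-s) * ((((j : ℕ) : ℂ) + 1)⁻¹) ^ i := by
    intro j i
    have hj : ((j : ℕ) : ℂ) + 1 ≠ 0 := natCast_add_one_ne_zero' j
    rw [neg_add, cpow_add _ _ hj, cpow_neg _ (i : ℂ), cpow_natCast, inv_pow]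
  rw [Fin.sum_univ_eq_sum_range (fun i ↦ p.coeff i * dirichletPoly a (s + (i : ℂ))) m]
  calc ∑ i ∈ Finset.range m, p.coeff i * dirichletPoly a (s + (i : ℂ))
      = ∑ i ∈ Finset.range m, ∑ j : Fin N, p.coeff i * (a j * (((j : ℕ) : ℂ) + 1) ^ (-(s + (i : ℂ)))) := by
        refine Finset.sum_congr rfl fun i _ ↦ ?_
        rw [dirichletPoly_apply, Finset.mul_sum]
    _ = ∑ j : Fin N, ∑ i ∈ Finset.range m, p.coeff i * (a j * (((j : ℕ) : ℂ) + 1) ^ (-(s + (i : ℂ)))) :=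
        Finset.sum_comm
    _ = ∑ j : Fin N, a j * (((j : ℕ) : ℂ) + 1) ^ (-s) * p.eval ((((j : ℕ) : ℂ) + 1)⁻¹) := by
        refine Finset.sum_congr rfl fun j _ ↦ ?_
        rw [eval_eq_sum_range' hm, Finset.mul_sum]
        refine Finset.sum_congr rfl fun i _ ↦ ?_
        rw [hterm]; ring
    _ = 0 := by
        refine Finset.sum_eq_zero fun j _ ↦ ?_
        by_cases hj : j ∈ S
        · rw [hroot j hj, mul_zero]
        · rw [hS j hj]; simp

/-! ## 2. Pointwise control on `Re z ≥ 2` by the Nyman–Beurling integral -/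

/-- **Point values from the distance** (no zero of `ζ` involved): for `Re z ≥ 2` and `I(N,a) ≤ i`,
`‖1 - ζ(z)A_a(z)‖ ≤ √i · ‖z‖²‖z+1‖²` — the tree's `norm_nbG_le_of_re` unwrapped at `z`. -/
theorem norm_one_sub_zeta_mul_dirichletPoly_le {N : ℕ} (a : Fin N → ℂ) {i : ℝ} (hi : 0 ≤ i)
    (hI : ∫⁻ t : ℝ, ENNReal.ofReal (‖1 - riemannZeta (1 / 2 + t * Complex.I) *
        ∑ n : Fin N, a n * ((n : ℂ) + 1) ^ (-(1 / 2 + t * Complex.I))‖ ^ 2 / (1 / 4 + t ^ 2)) ≤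
      ENNReal.ofReal i) {z : ℂ} (hz : 2 ≤ z.re) :
    ‖1 - riemannZeta z * dirichletPoly a z‖ ≤ Real.sqrt i * (‖z‖ ^ 2 * ‖z + 1‖ ^ 2) := by
  have hz1 : z ≠ 1 := by intro h; rw [h] at hz; norm_num at hz
  have hz0 : z ≠ 0 := by intro h; rw [h] at hz; norm_num at hz
  have hzp1 : z + 1 ≠ 0 := by
    intro h
    have : (z + 1).re = 0 := by rw [h]; simp
    simp at this; linarith
  have hzre : 1 / 2 < z.re := by linarith
  set G : ℂ → ℂ := fun s ↦ (s - 1 - riemannZeta₁ s * dirichletPoly a s) / (s ^ 2 * (s + 1) ^ 2)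
    with hGdef
  have hG : ∀ s, G s = (s - 1 - riemannZeta₁ s * dirichletPoly a s) / (s ^ 2 * (s + 1) ^ 2) :=
    fun s ↦ rfl
  have hGz : ‖G z‖ ≤ Real.sqrt i := by
    have h := norm_nbG_le_of_re hzre a hG hi hI
    have h2 : Real.sqrt i / (z.re - 1 / 2) ≤ Real.sqrt i := by
      rw [div_le_iff₀ (by linarith)]
      have := Real.sqrt_nonneg i
      nlinarith
    exact h.trans h2
  have hζ₁ : riemannZeta₁ z = (z - 1) * riemannZeta z := by
    rw [riemannZeta_eq_inv_sub_mul hz1]; field_simp [sub_ne_zero.mpr hz1]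
  have hden : z ^ 2 * (z + 1) ^ 2 ≠ 0 := mul_ne_zero (pow_ne_zero _ hz0) (pow_ne_zero _ hzp1)
  have hkey' : G z * (z ^ 2 * (z + 1) ^ 2) = (z - 1) * (1 - riemannZeta z * dirichletPoly a z) := by
    rw [hG, div_mul_cancel₀ _ hden, hζ₁]; ring
  have hkey : 1 - riemannZeta z * dirichletPoly a z = G z * (z ^ 2 * (z + 1) ^ 2) / (z - 1) := by
    rw [hkey', mul_div_cancel_left₀ _ (sub_ne_zero.mpr hz1)]
  have hzm1 : 1 ≤ ‖z - 1‖ := by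
    have h1 := abs_re_le_norm (z - 1)
    have h2 : (z - 1).re = z.re - 1 := by simp
    rw [h2] at h1
    have h3 := le_abs_self (z.re - 1)
    linarith
  rw [hkey, norm_div, norm_mul, norm_mul, norm_pow, norm_pow]
  calc ‖G z‖ * (‖z‖ ^ 2 * ‖z + 1‖ ^ 2) / ‖z - 1‖
      ≤ ‖G z‖ * (‖z‖ ^ 2 * ‖z + 1‖ ^ 2) := div_le_self (by positivity) hzm1
    _ ≤ Real.sqrt i * (‖z‖ ^ 2 * ‖z + 1‖ ^ 2) := by gcongr

/-- **Pointwise inversion of `ζ`.** Along Dirichlet polynomials `A_k` with `I(N_k,a_k) ≤ δ_k → 0`,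
`A_k(z) → 1/ζ(z)` for every `z` with `Re z ≥ 2`. -/
theorem tendsto_dirichletPoly_of_lintegral_le {N : ℕ → ℕ} (a : ∀ k, Fin (N k) → ℂ) {δ : ℕ → ℝ}
    (hδ0 : ∀ k, 0 ≤ δ k) (hδ : Tendsto δ atTop (𝓝 0))
    (hI : ∀ k, ∫⁻ t : ℝ, ENNReal.ofReal (‖1 - riemannZeta (1 / 2 + t * Complex.I) *
        ∑ n : Fin (N k), a k n * ((n : ℂ) + 1) ^ (-(1 / 2 + t * Complex.I))‖ ^ 2 / (1 / 4 + t ^ 2)) ≤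
      ENNReal.ofReal (δ k)) {z : ℂ} (hz : 2 ≤ z.re) :
    Tendsto (fun k ↦ dirichletPoly (a k) z) atTop (𝓝 (riemannZeta z)⁻¹) := by
  have hζ : riemannZeta z ≠ 0 := riemannZeta_ne_zero_of_one_lt_re (by linarith)
  have h1 : Tendsto (fun k ↦ riemannZeta z * dirichletPoly (a k) z) atTop (𝓝 1) := by
    refine tendsto_iff_norm_sub_tendsto_zero.mpr ?_
    have hC : Tendsto (fun k ↦ Real.sqrt (δ k) * (‖z‖ ^ 2 * ‖z + 1‖ ^ 2)) atTop (𝓝 0) := by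
      have := hδ.sqrt.mul_const (‖z‖ ^ 2 * ‖z + 1‖ ^ 2)
      simpa using this
    refine squeeze_zero (fun k ↦ norm_nonneg _) (fun k ↦ ?_) hC
    rw [norm_sub_rev]
    exact norm_one_sub_zeta_mul_dirichletPoly_le (a k) (hδ0 k) (hI k) hz
  have h2 := h1.const_mul (riemannZeta z)⁻¹
  rw [mul_one] at h2
  refine h2.congr fun k ↦ ?_
  rw [← mul_assoc, inv_mul_cancel₀ hζ, one_mul]

/-! ## 3. Linear independence of the unit shifts of `1/ζ` -/

/-- **The shifts `1/ζ(·+i)`, `i < m`, are linearly independent on `[2,∞)`.**  If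
`∑_{i<m} c_i/ζ(x+i) = 0` for all real `x ≥ 2` then `c = 0`: with `P = Σ c_i X^i` the Dirichlet series of
`n ↦ μ(n)P(1/n)` vanishes for `x ≥ 2`, so `μ(n)P(1/n) = 0` for all `n ≥ 1` (uniqueness of Dirichlet
coefficients), whence `P(1/q) = 0` for every prime `q` and `P = 0`. -/
theorem eq_zero_of_sum_mul_inv_zeta_shift_eq_zero {m : ℕ} (c : Fin m → ℂ)
    (h : ∀ x : ℝ, 2 ≤ x → ∑ i : Fin m, c i * (riemannZeta ((x : ℂ) + ((i : ℕ) : ℂ)))⁻¹ = 0) :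
    ∀ i, c i = 0 := by
  set P : ℂ[X] := ∑ i : Fin m, C (c i) * X ^ (i : ℕ) with hPdef
  have heval : ∀ z : ℂ, P.eval z = ∑ i : Fin m, c i * z ^ (i : ℕ) := by
    intro z; simp [hPdef, eval_finsetSum]
  set b : ℕ → ℂ := fun n ↦ (ArithmeticFunction.moebius n : ℂ) * P.eval ((n : ℂ)⁻¹) with hbdef
  -- the Dirichlet series of `b` is `∑ c_i / ζ(x+i)`
  have hterm : ∀ (x : ℝ) (n : ℕ), term b (x : ℂ) n =
      ∑ i : Fin m, c i * term (fun n ↦ (ArithmeticFunction.moebius n : ℂ)) ((x : ℂ) + ((i : ℕ) : ℂ)) n := by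
    intro x n
    rcases eq_or_ne n 0 with rfl | hn
    · simp [term_zero]
    have hn' : (n : ℂ) ≠ 0 := Nat.cast_ne_zero.mpr hn
    simp only [term_of_ne_zero hn, hbdef, heval, Finset.mul_sum, Finset.sum_div]
    refine Finset.sum_congr rfl fun i _ ↦ ?_
    rw [cpow_add _ _ hn', cpow_natCast, inv_pow]
    field_simp
  have hL : ∀ x : ℝ, 2 ≤ x →
      LSeries b x = ∑ i : Fin m, c i * (riemannZeta ((x : ℂ) + ((i : ℕ) : ℂ)))⁻¹ := by
    intro x hx
    have hre : ∀ i : Fin m, 1 < ((x : ℂ) + ((i : ℕ) : ℂ)).re := by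
      intro i
      simp only [add_re, ofReal_re, natCast_re]
      linarith [(i : ℕ).cast_nonneg (α := ℝ)]
    rw [LSeries]
    simp_rw [hterm x]
    rw [Summable.tsum_finsetSum (fun i _ ↦
      (ArithmeticFunction.LSeriesSummable_moebius_iff.mpr (hre i)).mul_left (c i))]
    refine Finset.sum_congr rfl fun i _ ↦ ?_
    rw [tsum_mul_left]
    congr 1
    have h1 := ArithmeticFunction.LSeries_zeta_mul_Lseries_moebius (hre i)
    rw [ArithmeticFunction.LSeries_zeta_eq_riemannZeta (hre i)] at h1
    exact eq_inv_of_mul_eq_one_right h1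
  -- `b` is bounded, so its abscissa of absolute convergence is finite
  have habs : abscissaOfAbsConv b ≤ 1 := by
    refine abscissaOfAbsConv_le_of_le_const ⟨∑ i : Fin m, ‖c i‖, fun n hn ↦ ?_⟩
    have hμ : ‖(ArithmeticFunction.moebius n : ℂ)‖ ≤ 1 := by
      norm_cast
      exact ArithmeticFunction.abs_moebius_le_one
    have hninv : ‖((n : ℂ))⁻¹‖ ≤ 1 := by
      rw [norm_inv, Complex.norm_natCast]
      exact inv_le_one_of_one_le₀ (by exact_mod_cast Nat.one_le_iff_ne_zero.mpr hn)
    have hP : ‖P.eval ((n : ℂ)⁻¹)‖ ≤ ∑ i : Fin m, ‖c i‖ := by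
      rw [heval]
      refine (norm_sum_le _ _).trans (Finset.sum_le_sum fun i _ ↦ ?_)
      rw [norm_mul, norm_pow]
      calc ‖c i‖ * ‖((n : ℂ))⁻¹‖ ^ (i : ℕ) ≤ ‖c i‖ * 1 := by
            gcongr; exact pow_le_one₀ (norm_nonneg _) hninv
        _ = ‖c i‖ := mul_one _
    calc ‖b n‖ = ‖(ArithmeticFunction.moebius n : ℂ)‖ * ‖P.eval ((n : ℂ)⁻¹)‖ := norm_mul _ _
      _ ≤ 1 * ∑ i : Fin m, ‖c i‖ := by gcongr
      _ = ∑ i : Fin m, ‖c i‖ := one_mul _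
  have htop : abscissaOfAbsConv b < ⊤ := habs.trans_lt (by exact_mod_cast EReal.coe_lt_top 1)
  -- uniqueness of Dirichlet coefficients
  have hev : (fun x : ℝ ↦ LSeries b x) =ᶠ[atTop] 0 :=
    Filter.eventually_atTop.mpr ⟨2, fun x hx ↦ by
      show LSeries b x = 0
      rw [hL x hx, h x hx]⟩
  have hb0 : ∀ n ≠ 0, b n = 0 := (LSeries_eventually_eq_zero_iff'.mp hev).resolve_right htop.ne
  -- `P` vanishes at `1/q` for every prime `q`, hence `P = 0`
  have hroot : ∀ q : ℕ, q.Prime → P.IsRoot ((q : ℂ)⁻¹) := by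
    intro q hq
    have h0 := hb0 q hq.ne_zero
    simp only [hbdef, ArithmeticFunction.moebius_apply_prime hq, Int.cast_neg, Int.cast_one,
      neg_one_mul, neg_eq_zero] at h0
    exact h0
  have hinf : Set.Infinite {z : ℂ | P.IsRoot z} := by
    have hinj : Set.InjOn (fun q : ℕ ↦ ((q : ℂ))⁻¹) {q | q.Prime} := by
      intro p _ q _ hpq
      exact_mod_cast (inv_inj.mp hpq : (p : ℂ) = q)
    refine ((Set.infinite_image_iff hinj).mpr Nat.infinite_setOf_prime).mono ?_
    rintro _ ⟨q, hq, rfl⟩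
    exact hroot q hq
  have hP0 : P = 0 := eq_zero_of_infinite_isRoot P hinf
  intro i
  have hci : P.coeff (i : ℕ) = c i := by
    simp only [hPdef, finsetSum_coeff, coeff_C_mul_X_pow]
    simp [Fin.val_inj]
  rw [← hci, hP0, coeff_zero]

/-! ## 4. V35 refuted: no boundedly-supported Nyman–Beurling approximation -/

/-- **V35 «SPARSE(B)» refuted, for every `B`.**  It is NOT the case that for every `ε > 0` some
Dirichlet polynomial with at most `B` nonzero coefficients has Nyman–Beurling integral
`I(N,a) = ∫ |1-ζA|²(1/2+it) dt/(1/4+t²) < ε`.  (E_NB integrand verbatim; no zero of `ζ` is used.) -/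
theorem not_nbSparseApprox (B : ℕ) :
    ¬ ∀ ε : ℝ, 0 < ε → ∃ (N : ℕ) (a : Fin N → ℂ),
      (Finset.univ.filter (fun n => a n ≠ 0)).card ≤ B ∧
      ∫⁻ t : ℝ, ENNReal.ofReal (‖1 - riemannZeta (1 / 2 + t * Complex.I) *
        ∑ n : Fin N, a n * ((n : ℂ) + 1) ^ (-(1 / 2 + t * Complex.I))‖ ^ 2 / (1 / 4 + t ^ 2)) <
        ENNReal.ofReal ε := by
  intro H
  choose N a hcard hI using fun k : ℕ ↦ H (1 / ((k : ℝ) + 1)) (by positivity)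
  -- supports and annihilating polynomials
  set S : ∀ k, Finset (Fin (N k)) := fun k ↦ Finset.univ.filter (fun n => a k n ≠ 0) with hSdef
  have hS : ∀ k n, n ∉ S k → a k n = 0 := by
    intro k n hn
    by_contra hne
    exact hn (Finset.mem_filter.mpr ⟨Finset.mem_univ _, hne⟩)
  set p : ∀ k : ℕ, ℂ[X] := fun k ↦ ∏ j ∈ S k, (X - C ((((j : ℕ) : ℂ) + 1)⁻¹)) with hpdef
  have hpdeg : ∀ k, (p k).natDegree ≤ B := by
    intro k
    show (∏ j ∈ S k, (X - C ((((j : ℕ) : ℂ) + 1)⁻¹))).natDegree ≤ B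
    rw [natDegree_finsetProd_X_sub_C_eq_card]
    exact hcard k
  have hpmonic : ∀ k, (p k).Monic := fun k ↦
    monic_prod_X_sub_C (fun j : Fin (N k) ↦ ((((j : ℕ) : ℂ) + 1)⁻¹)) (S k)
  -- normalised coefficient vectors in `ℂ^{B+1}`
  set u : ℕ → (Fin (B + 1) → ℂ) := fun k i ↦ (p k).coeff i with hudef
  have hu1 : ∀ k, 1 ≤ ‖u k‖ := by
    intro k
    have h1 : ‖u k ⟨(p k).natDegree, Nat.lt_succ_of_le (hpdeg k)⟩‖ = 1 := by
      show ‖(p k).coeff (p k).natDegree‖ = 1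
      rw [(hpmonic k).coeff_natDegree, norm_one]
    rw [← h1]
    exact norm_le_pi_norm (u k) _
  have hupos : ∀ k, 0 < ‖u k‖ := fun k ↦ lt_of_lt_of_le one_pos (hu1 k)
  set v : ℕ → (Fin (B + 1) → ℂ) := fun k ↦ ((‖u k‖ : ℝ) : ℂ)⁻¹ • u k with hvdef
  have hv1 : ∀ k, ‖v k‖ = 1 := by
    intro k
    show ‖((‖u k‖ : ℝ) : ℂ)⁻¹ • u k‖ = 1
    rw [norm_smul, norm_inv, Complex.norm_real, norm_norm, inv_mul_cancel₀ (hupos k).ne']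
  -- the recurrence, normalised
  have hrel : ∀ k (s : ℂ), ∑ i : Fin (B + 1), v k i * dirichletPoly (a k) (s + ((i : ℕ) : ℂ)) = 0 := by
    intro k s
    have h0 : ∑ i : Fin (B + 1), (p k).coeff i * dirichletPoly (a k) (s + ((i : ℕ) : ℂ)) = 0 :=
      sum_coeff_mul_dirichletPoly_shift_eq_zero (a k) (S k) (hS k) rfl
        (Nat.lt_succ_of_le (hpdeg k)) s
    calc ∑ i : Fin (B + 1), v k i * dirichletPoly (a k) (s + ((i : ℕ) : ℂ))
        = ((‖u k‖ : ℝ) : ℂ)⁻¹ *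
            ∑ i : Fin (B + 1), (p k).coeff i * dirichletPoly (a k) (s + ((i : ℕ) : ℂ)) := by
          rw [Finset.mul_sum]
          refine Finset.sum_congr rfl fun i _ ↦ ?_
          simp [hvdef, hudef, mul_assoc]
      _ = 0 := by rw [h0, mul_zero]
  -- Bolzano–Weierstrass on the unit sphere of `ℂ^{B+1}`
  obtain ⟨w, -, φ, hφ, hw⟩ := tendsto_subseq_of_bounded
    (Metric.isBounded_closedBall (x := (0 : Fin (B + 1) → ℂ)) (r := 1)) (x := v)
    (fun k ↦ mem_closedBall_zero_iff.mpr (hv1 k).le)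
  have hw1 : ‖w‖ = 1 := by
    have h1 : Tendsto (fun k ↦ ‖(v ∘ φ) k‖) atTop (𝓝 ‖w‖) := (continuous_norm.tendsto w).comp hw
    have h2 : (fun k ↦ ‖(v ∘ φ) k‖) = fun _ ↦ 1 := funext fun k ↦ hv1 (φ k)
    rw [h2] at h1
    exact (tendsto_nhds_unique tendsto_const_nhds h1).symm
  -- pointwise limits `A_{φ k}(z) → 1/ζ(z)` on `Re z ≥ 2`
  have hA : ∀ z : ℂ, 2 ≤ z.re →
      Tendsto (fun k ↦ dirichletPoly (a (φ k)) z) atTop (𝓝 (riemannZeta z)⁻¹) := by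
    intro z hz
    have h := tendsto_dirichletPoly_of_lintegral_le a (δ := fun k ↦ 1 / ((k : ℝ) + 1))
      (fun k ↦ by positivity) tendsto_one_div_add_atTop_nhds_zero_nat (fun k ↦ (hI k).le) hz
    exact h.comp hφ.tendsto_atTop
  -- the limit relation `∑ w_i / ζ(x+i) = 0` for real `x ≥ 2`
  have hlim : ∀ x : ℝ, 2 ≤ x → ∑ i : Fin (B + 1), w i * (riemannZeta ((x : ℂ) + ((i : ℕ) : ℂ)))⁻¹ = 0 := by
    intro x hx
    have hre : ∀ i : Fin (B + 1), 2 ≤ ((x : ℂ) + ((i : ℕ) : ℂ)).re := by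
      intro i
      simp only [add_re, ofReal_re, natCast_re]
      linarith [(i : ℕ).cast_nonneg (α := ℝ)]
    have h1 : Tendsto (fun k ↦ ∑ i : Fin (B + 1), (v ∘ φ) k i * dirichletPoly (a (φ k)) ((x : ℂ) + ((i : ℕ) : ℂ)))
        atTop (𝓝 (∑ i : Fin (B + 1), w i * (riemannZeta ((x : ℂ) + ((i : ℕ) : ℂ)))⁻¹)) := by
      refine tendsto_finsetSum _ fun i _ ↦ ?_
      exact ((tendsto_pi_nhds.mp hw) i).mul (hA _ (hre i))
    have h2 : (fun k ↦ ∑ i : Fin (B + 1), (v ∘ φ) k i * dirichletPoly (a (φ k)) ((x : ℂ) + ((i : ℕ) : ℂ))) =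
        fun _ ↦ 0 := funext fun k ↦ hrel (φ k) x
    rw [h2] at h1
    exact (tendsto_nhds_unique tendsto_const_nhds h1).symm
  -- independence of the shifts forces `w = 0`, contradicting `‖w‖ = 1`
  have hw0 : w = 0 := funext (eq_zero_of_sum_mul_inv_zeta_shift_eq_zero w hlim)
  rw [hw0, norm_zero] at hw1
  exact zero_ne_one hw1

/-- **Sparsity floor (positive form of V35).** For every `B` there is `ε(B) > 0` below which no
Dirichlet polynomial with at most `B` nonzero coefficients can push the Nyman–Beurling integral:
the support of near-optimal approximants must grow without bound. -/
theorem nbSparse_floor (B : ℕ) :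
    ∃ ε : ℝ, 0 < ε ∧ ∀ (N : ℕ) (a : Fin N → ℂ),
      (Finset.univ.filter (fun n => a n ≠ 0)).card ≤ B →
      ENNReal.ofReal ε ≤ ∫⁻ t : ℝ, ENNReal.ofReal (‖1 - riemannZeta (1 / 2 + t * Complex.I) *
        ∑ n : Fin N, a n * ((n : ℂ) + 1) ^ (-(1 / 2 + t * Complex.I))‖ ^ 2 / (1 / 4 + t ^ 2)) := by
  by_contra h
  push Not at h
  exact not_nbSparseApprox B h

/-- **Label (mechanical bookkeeping).** SPARSE(B) is an RH-PLUS conjunct: dropping the support bound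
gives the route thesis `NbThesis`, hence RH by the tree's calibration `nbThesis_iff`.  Together with
`not_nbSparseApprox` the would-be splitting `SPARSE(B) ∧ ⊤ ⟹ RH` is idle (false antecedent). -/
theorem rh_of_nbSparseApprox (B : ℕ)
    (h : ∀ ε : ℝ, 0 < ε → ∃ (N : ℕ) (a : Fin N → ℂ),
      (Finset.univ.filter (fun n => a n ≠ 0)).card ≤ B ∧
      ∫⁻ t : ℝ, ENNReal.ofReal (‖1 - riemannZeta (1 / 2 + t * Complex.I) *
        ∑ n : Fin N, a n * ((n : ℂ) + 1) ^ (-(1 / 2 + t * Complex.I))‖ ^ 2 / (1 / 4 + t ^ 2)) <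
        ENNReal.ofReal ε) : Summit.RiemannHypothesis :=
  Summit.RiemannHypothesis.RiemannHypothesis.Theorems.nbThesis_iff.mp fun ε hε ↦ by
    obtain ⟨N, a, -, hI⟩ := h ε hε
    exact ⟨N, a, hI⟩

end Summit.RiemannHypothesis.RiemannHypothesis.Theorems.Splittings.NbSparsity
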